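import Literature.NumberTheory.PAdicHodge.BmaxPlusTatePeriodHom
import Literature.NumberTheory.PAdicHodge.BmaxPlusToBdRPeriods
import Literature.NumberTheory.PAdicHodge.BmaxPlusFormalLogFrobeniusNondegenerate
import Literature.NumberTheory.PAdicHodge.AinfWeierstrassOmegaPeriodNonvanishing
import HarnessLib

/-!
# The φ-road's HONEST period maps `Pω, Pη : T_pŴ(𝒪_{ℂ_F}) →+ B_dR⁺(F)`: `ℤ_p`-linear, `Γ_F`-equivariant, `Pω = p^N·∫ω ∈ Fil¹`, `Pη ∉ Fil¹`

Topic `Literature/NumberTheory/PAdicHodge`; namespace `Literature.NumberTheory.PAdicHodge.AinfTop`. THEOREMS ONLY (no definition, no named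
fact, no instance, no `sorry`). The B8b PACKAGE of the φ-road of line `kato_lever` (crux K★ `stmt-BirchSwinnertonDyer-22226`, memo
`Summits/…/Cruxes/StarredOptimalManinUnitFiveSeven/Lines/kato-lever-K2-tower-instantiation.md` §3): for an integral Weierstrass equation `W/ℤ` and
`N ≥ 1`, the `A_max`-period map `Lh : T_pŴ →+ A_max` (`BmaxPlusTatePeriodHom.exists_addMonoidHom_logSum_torsionLiftHom`, `Lh τ = Λ_N(ι[τ̃], z)`)
composed with the honest comparison `bmaxPlusToBdR : B_max⁺ → B_dR⁺` (`BmaxPlusToBdR`) and with `φ`: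

* ★★★ `exists_phiRoad_periodHoms` — HONEST additive maps `Pω := bmaxPlusToBdR ∘ Lh`, `Pη := bmaxPlusToBdR ∘ φ ∘ Lh : TatePt F p W →+ BdRPlusTop F p`
  with: `Pω τ = p^N·∫_τ ω` (K1's `omegaPeriodHom`; `BmaxPlusToBdRPeriods`), `ℤ_p`-LINEARITY `P(c·τ) = ι(c)·P(τ)` for both, `Γ_F`-EQUIVARIANCE
  `σ(P τ) = P(σ·τ)` for both, `Pω τ ∈ Fil¹` — the hypotheses `hPωZ, hPηZ, hPω, hPη, hfil` of the socket's capstone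
  (`TatePairingPointOfKTwoBasis.exists_const_tatePairingPoint_eq_neg_trace_of_KTwoBasis`, up to the identification `TatePt ≃ T_pW`);
* ★★ `exists_phiRoad_periodHoms_supersingular` — at a prime `p ≥ 5` of good SUPERSINGULAR reduction moreover `∃ τ, Pω τ ≠ 0` (`hne`,
  `exists_omegaPeriodHom_ne_zero`) and **`∃ τ, Pη τ ∉ Fil¹`** (`hnot`, `BmaxPlusFormalLogFrobeniusNondegenerate`);
* ★★ `isTeichLog_phiRoad_resolution` — (K₂) for these maps: for any `Λ ∈ A_max` with the Honda relation (e.g. the period `Λ_{N′}(ι[ũ])` of a division sequence of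
  a rational point) and `bω := bmaxPlusToBdR Λ`, `bη := bmaxPlusToBdR (φΛ)`: **`IsTeichLog k (p^M·(Pη τ·bω − Pω τ·bη))`** for every `τ` and `k ≥ 1`
  (`BmaxPlusToBdRPeriods.isTeichLog_pow_mul_bmaxPlusToBdR_det_of_honda`).

What is left to the socket's owner: the matching `TatePt F p W ≃ W.tateModule p` / `restrictedTateRep` (K1's `KummerCocycleOfMatching`), the Kummer-cocycle
integrating identities at the rational point, and the Legendre constant (B8a). Infrastructure only; BSD / K★ are not proved by any of this.

## References
* P. Colmez, *Périodes p-adiques des variétés abéliennes*, Math. Ann. 292 (1992), §2. [Colmez1992PeriodesAbeliennes]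
* J.-M. Fontaine, *Le corps des périodes p-adiques*, Astérisque 223 (1994), Exp. II §1.5, Exp. III Th. 5.3.7. [FontaineAsterisque223III]
* K. Kato, LNM 1553 (1993), Ch. II §1.4. [Kato1993LNM1553]
-/

noncomputable section

open Ideal WittVector ValuativeRel Field

namespace Literature.NumberTheory.PAdicHodge

namespace AinfTop

open Literature.NumberTheory.GaloisRepresentations Literature.NumberTheory.GaloisRepresentations.IsNonarchimedeanLocalField
open Literature.NumberTheory.GaloisRepresentations.LubinTate Literature.NumberTheory.EllipticCurves
open Literature.RingTheory.FormalGroups Literature.AlgebraicGeometry.Resolution GaloisContinuity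

variable {F : Type} [Field F] [ValuativeRel F] [TopologicalSpace F] [IsNonarchimedeanLocalField F]
  [CharZero F] {p : ℕ} [Fact p.Prime] [Fact (¬ IsUnit (p : integerC F))]
  [IsAdicComplete (Ideal.span {(p : integerC F)}) (integerC F)]
  {hθ : Function.Surjective (fontaineTheta (integerC F) p)} (W : WeierstrassCurve ℤ)

/-! ## §1 The honest period maps -/

set_option maxHeartbeats 3200000 in
/-- ★★★ **The φ-road's honest period maps.** For `W/ℤ`, `N ≥ 1`: there are an additive `Lh : T_pŴ(𝒪_{ℂ_F}) →+ A_max` with `Lh τ = Λ_N(ι[τ̃], z)` for every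
witness, and additive `Pω, Pη : T_pŴ(𝒪_{ℂ_F}) →+ B_dR⁺(F)` with `Pω = bmaxPlusToBdR ∘ Lh`, `Pη = bmaxPlusToBdR ∘ φ ∘ Lh`, such that:
`Pω τ = p^N · ∫_τ ω` (K1's `omegaPeriodHom`), both maps are `ℤ_p`-linear (`P(c·τ) = ι(c)·P(τ)`) and `Γ_F`-equivariant (`σ(P τ) = P(σ·τ)`), and
`Pω τ ∈ Fil¹ B_dR⁺`. [cite: Colmez1992PeriodesAbeliennes, §2] [cite: FontaineAsterisque223III, Exp. II §1.5] -/
theorem exists_phiRoad_periodHoms {N : ℕ} (hN : 1 ≤ N) :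
    ∃ (Lh : TatePt F p W →+ BmaxPlus F p) (Pω Pη : TatePt F p W →+ BdRPlusTop F p),
      (∀ (τ : TatePt F p W) (z : bmaxZero F p),
        algebraMap (Ainf (p := p) F) (bmaxZero F p)
            ((of F p).symm (((torsionLiftHom W hθ τ).val : (nilTheta F p hθ).toIdeal) : AinfTop F p)) ^ N = (p : bmaxZero F p) * z →
        Lh τ = PadicLogSeries.logSum ((algebraMap (Ainf (p := p) F) (bmaxZero F p)).comp zpToAinf) (GaloisContinuity.formalLogNum W p) N
          (algebraMap (Ainf (p := p) F) (bmaxZero F p)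
            ((of F p).symm (((torsionLiftHom W hθ τ).val : (nilTheta F p hθ).toIdeal) : AinfTop F p))) z) ∧
      (∀ τ, Pω τ = BdRPlusTop.of F p (bmaxPlusToBdR F p (Lh τ))) ∧
      (∀ τ, Pη τ = BdRPlusTop.of F p (bmaxPlusToBdR F p (frobBmaxPlus F p (Lh τ)))) ∧
      (∀ τ, Pω τ = (p : BdRPlusTop F p) ^ N * omegaPeriodHom W hθ τ) ∧
      (∀ (c : ℤ_[p]) (τ : TatePt F p W), Pω (c • τ) = BdRPlusTop.of F p (qpToBdR (c : ℚ_[p])) * Pω τ) ∧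
      (∀ (c : ℤ_[p]) (τ : TatePt F p W), Pη (c • τ) = BdRPlusTop.of F p (qpToBdR (c : ℚ_[p])) * Pη τ) ∧
      (∀ (σ : absoluteGaloisGroup F) (τ : TatePt F p W), BdRPlusTop.gal F p σ (Pω τ) = Pω (σ • τ)) ∧
      (∀ (σ : absoluteGaloisGroup F) (τ : TatePt F p W), BdRPlusTop.gal F p σ (Pη τ) = Pη (σ • τ)) ∧
      (∀ τ, Pω τ ∈ (BdRPlusTop.filOne F p).toIdeal) := by
  obtain ⟨Lh, hLh, hsmul, hgal, -⟩ := exists_addMonoidHom_logSum_torsionLiftHom W (hθ := hθ) hN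
  -- the two compositions
  let f : BmaxPlus F p →+* BdRPlusTop F p := (BdRPlusTop.of F p).toRingHom.comp (bmaxPlusToBdR F p)
  let Pω : TatePt F p W →+ BdRPlusTop F p := f.toAddMonoidHom.comp Lh
  let Pη : TatePt F p W →+ BdRPlusTop F p := (f.comp (frobBmaxPlus F p)).toAddMonoidHom.comp Lh
  have hPω : ∀ τ, Pω τ = BdRPlusTop.of F p (bmaxPlusToBdR F p (Lh τ)) := fun τ => rfl
  have hPη : ∀ τ, Pη τ = BdRPlusTop.of F p (bmaxPlusToBdR F p (frobBmaxPlus F p (Lh τ))) := fun τ => rfl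
  -- `Pω = p^N · ∫ω`
  have hPωω : ∀ τ, Pω τ = (p : BdRPlusTop F p) ^ N * omegaPeriodHom W hθ τ := by
    intro τ
    obtain ⟨z, hz⟩ := exists_witness_of_thetaPt_eq_zero W _ (thetaPt_torsionLiftHom W (hθ := hθ) τ) hN
    have h := bmaxPlusToBdR_logSum_divisionLiftPt_torsion W (hθ := hθ) (seq_zero W τ) (mulPC_seq W τ) hN hz
    rw [hPω, hLh τ z hz]
    apply (BdRPlusTop.of F p).symm.injective
    rw [RingEquiv.symm_apply_apply, map_mul, map_pow, map_natCast, omegaPeriodHom_apply]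
    exact h
  -- the scalar `ι(c)` under `f` and `f ∘ φ`
  have hfc : ∀ c : ℤ_[p], f (ainfToBmaxPlus F p (zpToAinf c)) = BdRPlusTop.of F p (qpToBdR (c : ℚ_[p])) := fun c => by
    change BdRPlusTop.of F p (bmaxPlusToBdR F p (ainfToBmaxPlus F p (zpToAinf c))) = _
    rw [bmaxPlusToBdR_ainfToBmaxPlus_zpToAinf]
  have hφc : ∀ c : ℤ_[p], frobBmaxPlus F p (ainfToBmaxPlus F p (zpToAinf c)) = ainfToBmaxPlus F p (zpToAinf c) := fun c => by
    rw [frobBmaxPlus_ainfToBmaxPlus, frobenius_zpToAinf]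
  refine ⟨Lh, Pω, Pη, hLh, hPω, hPη, hPωω, ?_, ?_, ?_, ?_, ?_⟩
  · intro c τ
    change f (Lh (c • τ)) = _ * f (Lh τ)
    rw [hsmul, map_mul, hfc]
  · intro c τ
    change f (frobBmaxPlus F p (Lh (c • τ))) = _ * f (frobBmaxPlus F p (Lh τ))
    rw [hsmul, map_mul, hφc, map_mul, hfc]
  · intro σ τ
    change BdRPlusTop.gal F p σ (BdRPlusTop.of F p (bmaxPlusToBdR F p (Lh τ))) = BdRPlusTop.of F p (bmaxPlusToBdR F p (Lh (σ • τ)))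
    rw [BdRPlusTop.gal_of, galBdRPlus_bmaxPlusToBdR, hgal]
  · intro σ τ
    change BdRPlusTop.gal F p σ (BdRPlusTop.of F p (bmaxPlusToBdR F p (frobBmaxPlus F p (Lh τ)))) =
      BdRPlusTop.of F p (bmaxPlusToBdR F p (frobBmaxPlus F p (Lh (σ • τ))))
    rw [BdRPlusTop.gal_of, galBdRPlus_bmaxPlusToBdR, galBmaxPlus_frobBmaxPlus, hgal]
  · intro τ
    rw [hPωω]
    exact Ideal.mul_mem_left _ _ (omegaPeriodHom_mem_filOne W τ)

/-! ## §2 Non-degeneracy at supersingular primes: `Pω ≠ 0`, `Pη ∉ Fil¹` -/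

set_option maxHeartbeats 3200000 in
/-- ★★ **`Pω ≢ 0` and `Pη ∉ Fil¹` at a prime of good SUPERSINGULAR reduction** (`p ≥ 5`, `p ∤ Δ`, Hasse coefficient `0`; `W ⊗ ℚ_p`, `W ⊗ 𝔽_p` elliptic):
for the maps of `exists_phiRoad_periodHoms` (recognised through their characterisations `hLh`, `hPω`, `hPη`), some `τ` has `Pω τ ≠ 0`
(`exists_omegaPeriodHom_ne_zero`) and some `τ` has `Pη τ ∉ Fil¹ B_dR⁺` — `θ_dR(Pη τ) = θ_max(φ Λ_N(ι[τ̃])) = p^{N−1}·θ_max(φ Λ_1(ι[τ̃])) ≠ 0`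
(`BmaxPlusFormalLogFrobeniusNondegenerate`). These are `hne`, `hnot` of the socket's capstone. [cite: FontaineAsterisque223III, Exp. II §1.5]
[cite: Colmez1992PeriodesAbeliennes, §2] -/
theorem exists_phiRoad_periodHoms_supersingular (hp5 : 5 ≤ p) (hΔ : ¬ (p : ℤ) ∣ W.Δ)
    (hA : (W.map (Int.castRingHom (ZMod p))).hasseCoeff p = 0) [(W.map (Int.castRingHom ℚ_[p])).IsElliptic]
    [(W.map (Int.castRingHom (ZMod p))).IsElliptic] {N : ℕ} (hN : 1 ≤ N)
    {Lh : TatePt F p W →+ BmaxPlus F p} {Pω Pη : TatePt F p W →+ BdRPlusTop F p}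
    (hLh : ∀ (τ : TatePt F p W) (z : bmaxZero F p),
        algebraMap (Ainf (p := p) F) (bmaxZero F p)
            ((of F p).symm (((torsionLiftHom W hθ τ).val : (nilTheta F p hθ).toIdeal) : AinfTop F p)) ^ N = (p : bmaxZero F p) * z →
        Lh τ = PadicLogSeries.logSum ((algebraMap (Ainf (p := p) F) (bmaxZero F p)).comp zpToAinf) (GaloisContinuity.formalLogNum W p) N
          (algebraMap (Ainf (p := p) F) (bmaxZero F p)
            ((of F p).symm (((torsionLiftHom W hθ τ).val : (nilTheta F p hθ).toIdeal) : AinfTop F p))) z)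
    (hPω : ∀ τ, Pω τ = (p : BdRPlusTop F p) ^ N * omegaPeriodHom W hθ τ)
    (hPη : ∀ τ, Pη τ = BdRPlusTop.of F p (bmaxPlusToBdR F p (frobBmaxPlus F p (Lh τ)))) :
    (∃ τ, Pω τ ≠ 0) ∧ (∃ τ, Pη τ ∉ (BdRPlusTop.filOne F p).toIdeal) := by
  have hp : p.Prime := Fact.out
  haveI := isDomain_bmaxZero (F := F) (p := p)
  haveI := charZero_bmaxZero (F := F) (p := p)
  refine ⟨?_, ?_⟩
  · obtain ⟨τ, hτ⟩ := exists_omegaPeriodHom_ne_zero (F := F) W (hθ := hθ) hp5 hΔ hA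
    refine ⟨τ, fun h0 => hτ ?_⟩
    rw [hPω] at h0
    have hu : IsUnit ((p : BdRPlusTop F p) ^ N) := by
      have h := ((isUnit_natCast_bDeRhamPlus (F := F) (p := p) hp.ne_zero).pow N).map (BdRPlusTop.of F p)
      rwa [map_pow, map_natCast] at h
    exact (hu.mul_right_eq_zero).1 h0
  · obtain ⟨τ, z, hz, hne⟩ := exists_thetaBmaxPlus_frobBmaxPlus_logSum_ne_zero (F := F) W (hθ := hθ) hp5 hΔ hA
    -- a witness at index `N` and the relation `Λ_N = p^{N-1} Λ_1`
    obtain ⟨zN, hzN⟩ := exists_witness_of_thetaPt_eq_zero W _ (thetaPt_torsionLiftHom W (hθ := hθ) τ) hN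
    have hz1 : algebraMap (Ainf (p := p) F) (bmaxZero F p)
        ((of F p).symm (((torsionLiftHom W hθ τ).val : (nilTheta F p hθ).toIdeal) : AinfTop F p)) ^ 1 = (p : bmaxZero F p) * z := hz
    have hscale := PadicLogSeries.logSum_eq_pow_mul_logSum ((algebraMap (Ainf (p := p) F) (bmaxZero F p)).comp zpToAinf)
      (GaloisContinuity.formalLogNum W p) le_rfl hN hz1 hzN
    have hofpow : AdicCompletion.of (Ideal.span {(p : bmaxZero F p)}) (bmaxZero F p) ((p : bmaxZero F p) ^ (N - 1)) =
        (p : BmaxPlus F p) ^ (N - 1) := by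
      change algebraMap (bmaxZero F p) (BmaxPlus F p) ((p : bmaxZero F p) ^ (N - 1)) = _
      rw [map_pow, map_natCast]
    refine ⟨τ, fun hmem => hne ?_⟩
    -- `θ_dR(Pη τ) = 0`
    rw [BdRPlusTop.mem_filOne_iff, hPη, RingEquiv.symm_apply_apply, ← pow_one (xiBdR : BDeRhamPlus (integerC F) p)] at hmem
    have hθ0 := thetaBdR_eq_zero_of_mem_span_xiBdR_pow le_rfl hmem
    rw [thetaBdR_bmaxPlusToBdR] at hθ0
    have hθ0' : thetaBmaxPlus F p (frobBmaxPlus F p (Lh τ)) = 0 := Subtype.ext (by rw [hθ0]; rfl)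
    rw [hLh τ zN hzN, hscale, hofpow, map_mul, map_pow, map_natCast, map_mul, map_pow, map_natCast] at hθ0'
    -- `p^{N-1} θ_max(φΛ_1) = 0` forces `θ_max(φΛ_1) = 0`
    exact (mul_eq_zero.1 hθ0').resolve_left (pow_ne_zero _ (natCast_integerC_ne_zero hp.ne_zero))

/-! ## §3 (K₂) for the honest resolution -/

set_option maxHeartbeats 3200000 in
/-- ★★ **(K₂) for the φ-road's honest maps.** With `Pω, Pη` as in `exists_phiRoad_periodHoms` (through `hLh`, `hPω`, `hPη`), `W ⊗ ℚ_p`, `W ⊗ 𝔽_p` elliptic,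
and any `Λ ∈ A_max` satisfying the Honda relation `φ²Λ − ι(a_p)·φΛ + p·Λ = 0` (e.g. the period `Λ_{N′}(ι[ũ], z)` of a `[p]_W`-division sequence of a
rational point, `frobBmaxPlus_hondaTrace_logSum_divisionLiftPt_eq_zero`), put `bω := bmaxPlusToBdR Λ`, `bη := bmaxPlusToBdR (φΛ)`. Then for every `τ` and
`k ≥ 1`: **`IsTeichLog k (p^M·(Pη τ·bω − Pω τ·bη))`** for some `M` — the socket's `KTwoMembership` for the pair `(Pω, Pη)` and the integrating pair
`(bω, bη)`. [cite: Kato1993LNM1553, Ch. II §1.4] [cite: FontaineAsterisque223III, Exp. III Th. 5.3.7] -/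
theorem isTeichLog_phiRoad_resolution (hF : Function.Surjective (fontaineTheta (integerC F) p)) (hpv : valuation F p < 1)
    [(W.map (Int.castRingHom ℚ_[p])).IsElliptic] [(W.map (Int.castRingHom (ZMod p))).IsElliptic] {N : ℕ} (hN : 1 ≤ N)
    {Lh : TatePt F p W →+ BmaxPlus F p} {Pω Pη : TatePt F p W →+ BdRPlusTop F p}
    (hLh : ∀ (τ : TatePt F p W) (z : bmaxZero F p),
        algebraMap (Ainf (p := p) F) (bmaxZero F p)
            ((of F p).symm (((torsionLiftHom W hθ τ).val : (nilTheta F p hθ).toIdeal) : AinfTop F p)) ^ N = (p : bmaxZero F p) * z →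
        Lh τ = PadicLogSeries.logSum ((algebraMap (Ainf (p := p) F) (bmaxZero F p)).comp zpToAinf) (GaloisContinuity.formalLogNum W p) N
          (algebraMap (Ainf (p := p) F) (bmaxZero F p)
            ((of F p).symm (((torsionLiftHom W hθ τ).val : (nilTheta F p hθ).toIdeal) : AinfTop F p))) z)
    (hPω : ∀ τ, Pω τ = BdRPlusTop.of F p (bmaxPlusToBdR F p (Lh τ)))
    (hPη : ∀ τ, Pη τ = BdRPlusTop.of F p (bmaxPlusToBdR F p (frobBmaxPlus F p (Lh τ))))
    {Λ : BmaxPlus F p}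
    (hΛ : frobBmaxPlus F p (frobBmaxPlus F p Λ) -
        AdicCompletion.of (Ideal.span {(p : bmaxZero F p)}) (bmaxZero F p)
          (((algebraMap (Ainf (p := p) F) (bmaxZero F p)).comp zpToAinf)
            ((HasseManin.tr (W.map (Int.castRingHom (ZMod p))) : ℤ) : ℤ_[p])) * frobBmaxPlus F p Λ +
        AdicCompletion.of (Ideal.span {(p : bmaxZero F p)}) (bmaxZero F p) (p : bmaxZero F p) * Λ = 0)
    (τ : TatePt F p W) {k : ℕ} (hk : 1 ≤ k) :
    ∃ M : ℕ, IsTeichLog k ((BdRPlusTop.of F p).symm ((p : BdRPlusTop F p) ^ M *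
      (Pη τ * BdRPlusTop.of F p (bmaxPlusToBdR F p Λ) - Pω τ * BdRPlusTop.of F p (bmaxPlusToBdR F p (frobBmaxPlus F p Λ))))) := by
  obtain ⟨z, hz⟩ := exists_witness_of_thetaPt_eq_zero W _ (thetaPt_torsionLiftHom W (hθ := hθ) τ) hN
  have hofp : AdicCompletion.of (Ideal.span {(p : bmaxZero F p)}) (bmaxZero F p) (p : bmaxZero F p) = (p : BmaxPlus F p) :=
    map_natCast (algebraMap (bmaxZero F p) (BmaxPlus F p)) p
  -- the Honda relation for `Λ′ = Lh τ`
  have hΛ' := frobBmaxPlus_hondaTrace_logSum_divisionLiftPt_eq_zero W (hθ := hθ) (mulPC_seq W τ) hN hz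
  rw [hofp] at hΛ hΛ'
  have hΛ'' : frobBmaxPlus F p (frobBmaxPlus F p (Lh τ)) -
      AdicCompletion.of (Ideal.span {(p : bmaxZero F p)}) (bmaxZero F p)
        (((algebraMap (Ainf (p := p) F) (bmaxZero F p)).comp zpToAinf)
          ((HasseManin.tr (W.map (Int.castRingHom (ZMod p))) : ℤ) : ℤ_[p])) * frobBmaxPlus F p (Lh τ) +
      (p : BmaxPlus F p) * Lh τ = 0 := by
    rw [hLh τ z hz]; exact hΛ'
  obtain ⟨M, hM⟩ := isTeichLog_pow_mul_bmaxPlusToBdR_det_of_honda hF hpv hk hΛ hΛ''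
  refine ⟨M, ?_⟩
  rw [hPη, hPω]
  have e : (BdRPlusTop.of F p).symm ((p : BdRPlusTop F p) ^ M *
      (BdRPlusTop.of F p (bmaxPlusToBdR F p (frobBmaxPlus F p (Lh τ))) * BdRPlusTop.of F p (bmaxPlusToBdR F p Λ) -
        BdRPlusTop.of F p (bmaxPlusToBdR F p (Lh τ)) * BdRPlusTop.of F p (bmaxPlusToBdR F p (frobBmaxPlus F p Λ)))) =
      (p : BDeRhamPlus (integerC F) p) ^ M *
        (bmaxPlusToBdR F p Λ * bmaxPlusToBdR F p (frobBmaxPlus F p (Lh τ)) -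
          bmaxPlusToBdR F p (frobBmaxPlus F p Λ) * bmaxPlusToBdR F p (Lh τ)) := by
    simp only [map_mul, map_sub, map_pow, map_natCast, RingEquiv.symm_apply_apply]
    ring
  rw [e]
  exact hM

end AinfTop

end Literature.NumberTheory.PAdicHodge

end
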